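import Summits.BirchSwinnertonDyer.Rank1Residual.Additive.RamifiedSevenGenusKatoExpReading
import Literature.NumberTheory.EllipticCurves.IwasawaAlgebraCharacterEvaluationCongruence
import HarnessLib

set_option autoImplicit false

/-!
# `𝒞₇` genus road (crux `EllipticUnitValueSevenOfGZK`, K7r), pen D1125 row (K-1): the pinned frame's `exp*`-value reading
# `valOf` is `Λ`-SEMILINEAR through the tree's `charEval` (`valOf (f • x) = charEval(f) · valOf x` for ALL `f ∈ Λ`),
# the (M-CANCEL) threshold «a non-zero `M ∈ Λ` evaluates to `≠ 0` at every primitive character of large level», and `√−7 ∉ ℚ₇`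

Cell bsd-cm, seat bsd-cm-k-ty1 g34 (literature-prover; OWNER of (S-D-★′) `stub_katoExpUnitLawsSeven`, zp v20
a4ba175e5009387e; pen bsd-cm-plan g39 D1124/D1125; critic idea-crit-15 g18 NOTE #13 (W5-M)).  PURE KERNEL: no named fact, no
`sorry`, no `instance`, no notation; everything landed is untouched.  REUSE, not re-derivation: the evaluation character of
`Λ = ℤ₇⟦X⟧` at a level-`N` character IS the tree's `IwasawaAlgebra.charEval 7 ι u N` (`IwasawaAlgebraCharacterEvaluation.lean`,
Amice residues; `val_smul_eq_charEval_mul` = semilinearity of any `(1+X, C)`-semilinear value map; ★★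
`eq_zero_of_infinite_setOf_charEval_eq_zero` = separation of scalars by characters), so this file only SPECIALISES them to
the frame's `valOf` (whose generator laws (e1) `valOf_T_smul` / (e1′) `valOf_C_smul` are landed) and turns ★★ into the
threshold form the (H) derivation consumes (k-ty1 `FP1-CONSUMER-NOTE.md` §5: cancel `charEval(M̃) ≠ 0` for `n ≥ n_M̃`).

## Contents
* §1 `CharacterEvaluation.evalHom ι₇ ζ hζ : IwasawaAlgebra 7 →+* ℂ` (`ζ^{7ⁿ} = 1` for some `n`; `X ↦ ζ − 1`, constants via
  `ι₇`): the composite `Λ ↠ Λ/(ω_n) ≅ ℤ₇[X]/(ω_n) → ℂ` (Weierstrass division by the distinguished `ω_n = (X+1)^{7ⁿ} − 1`, the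
  tree's `IwasawaH1Exists.isDistinguishedAt_omega` / Mathlib `Polynomial.IsDistinguishedAt.algEquivQuotient`; `eval₂` at `ζ − 1`
  kills `ω_n`) — a genuine RING HOMOMORPHISM (so units go to non-zero numbers), with `evalHom_eq_eval₂` (level independence),
  `evalHom_coe/C/X/one_add_X`, and ★ `charEval_eq_evalHom`: the tree's Amice-residue evaluation `charEval 7 (ι₇∘ℤ₇) ζ N` IS
  `evalHom` whenever `ζ^{7^N} = 1` (by the tree's own `val_smul_eq_charEval_mul` applied to `ℂ` made a `Λ`-module through `evalHom`).
* §2 ★ `PinnedKatoGenusFrame.valOf_smul` — for `χ` trivial on `U_N` and EVERY `f ∈ Λ`: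
  `valOf ι₇ χ (f • x) = evalHom ι₇ (χ(γK)⁻¹) _ f · valOf ι₇ χ x` (the tree's `val_smul_eq_charEval_mul` at the value map
  `valOf ι₇ χ`, generator laws (e1) `valOf_T_smul` / (e1′) `valOf_C_smul`, then `charEval_eq_evalHom`); `valOf_units_inv_smul`
  (`u ∈ Λˣ`: `valOf (u⁻¹ • x) = evalHom(u)⁻¹ · valOf x`); `valOf_binomialSeries_smul` (Kato's twist operator `σ_𝔟 = (1+X)^a`,
  `a ∈ ℤ₇`, acts by `(χ(γK)⁻¹)^m` for any natural lift `m ≡ a (mod 7^N)` — the tree's `val_binomialSeries_smul`).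
* §3 ★ (M-CANCEL) `exists_level_forall_charEval_ne_zero` — for `M ≠ 0` in `Λ`: `∃ n₀, ∀ n ≥ n₀, ∀ ζ ∈ ℂ` primitive of order
  `7^{n+1}`, `charEval 7 (ι₇∘ℤ₇) ζ (n+1) M ≠ 0` (contrapositive of the tree's ★★ `eq_zero_of_infinite_setOf_charEval_eq_zero` through
  a chosen sequence of bad roots; `Complex.isPrimitiveRoot_exp` fills the good levels); `…evalHom_ne_zero` (the same for `evalHom`).
* §4 `not_isSquare_neg_seven_padic : ¬ IsSquare (-7 : ℚ_[7])` (valuations: `4·v(x) = v(49) = 2` is impossible) and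
  `eq_zero_of_add_mul_eq_zero_of_sq_eq_neg_seven` (`ι₇ a + ι₇ b·r = 0`, `r² = −7` ⇒ `a = b = 0`): the ★-law's branch constant
  `A = ι₇α₀ + ι₇α₁·ιC(√−7)` vanishes only for `α = 0` (pen D1124, (S-★′) «`A ≠ 0` since `√−7 ∉ ℚ₇`»).

HONEST LABEL: kernel algebra; nothing about Kato's values, `exp*`, `L`-values or the ★-constant is proved here;
stmt-BirchSwinnertonDyer-19945 stays OPEN (zp v20, 5 sorries); `X12.CMRamifiedSeven` is NOT proved; no summit statement is
proved; BSD is claimed for no curve.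

## References
* S. Lang, *Cyclotomic Fields I and II* (1990), Ch. 5 §1 Thm. 1.1, §2 Thm. 2.1 (Weierstrass division; `Λ ≅ lim← ℤ_p[X]/(ω_n)`). [Lang1990]
* L. Washington, *Introduction to Cyclotomic Fields* (1997), §7.1 Thm. 7.1 / Prop. 7.2, Thm. 7.3, §12.2 (p. 238), §13.2. [Washington1997]
* K. Kato, Astérisque 295 (2004), Thm. 12.5 (1) (p. 221), §13.9 (p. 230 l. 8–9), (15.12.2) (p. 263). [Kato2004Asterisque]
* J.-P. Serre, *Local Fields* (1979), II §1–§2 (valuations), IV §4 Prop. 17. [SerreLocalFields1979]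
* Tree: `IwasawaAlgebraCharacterEvaluation.lean` (`charEval`, `val_smul_eq_charEval_mul`, `eq_zero_of_infinite_setOf_charEval_eq_zero`),
  `IwasawaAlgebraCharacterEvaluationCongruence.lean` (`val_binomialSeries_smul`), `RamifiedSevenGenusKatoExpReading.lean` (`valOf`, (e1), (e1′)),
  `RamifiedSevenGenusKatoExpFrame.lean` (`inv_chi_γK_pow_eq_one`).
-/

noncomputable section

open scoped NumberField
open Polynomial
open Field IsDedekindDomain NumberField
open Literature.NumberTheory.GaloisRepresentations
open Literature.NumberTheory.EllipticCurves
open Literature.NumberTheory.EllipticCurves.Rank1Residual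
open Literature.NumberTheory.EllipticCurves.IwasawaAlgebra
open Literature.NumberTheory.EllipticCurves.Kato2004
open Literature.NumberTheory.ComplexMultiplication.EllipticUnits
open Summit.BirchSwinnertonDyer.Rank1Residual

namespace Summit.BirchSwinnertonDyer.Rank1Residual.Additive.GenusSeven

/-! ## §1 The evaluation character `ρ_{ι₇,ζ} : Λ → ℂ` as a ring homomorphism, and `charEval = ρ` -/

namespace CharacterEvaluation

/-- `ω_k(ζ − 1) = ζ^{7^k} − 1` under `eval₂`. [cite: Washington1997, §7.1] -/
theorem eval₂_omega (ι : ℤ_[7] →+* ℂ) (ζ : ℂ) (k : ℕ) :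
    eval₂ ι (ζ - 1) ((X + 1 : ℤ_[7][X]) ^ 7 ^ k - 1) = ζ ^ 7 ^ k - 1 := by
  simp [eval₂_sub, eval₂_pow, eval₂_add, sub_add_cancel]

/-- `eval₂` at `ζ − 1` kills the ideal `(ω_k)` when `ζ^{7^k} = 1`. [cite: Washington1997, §7.1] -/
theorem eval₂_eq_zero_of_mem_span_omega (ι : ℤ_[7] →+* ℂ) {ζ : ℂ} {k : ℕ} (hζ : ζ ^ 7 ^ k = 1)
    {a : ℤ_[7][X]} (ha : a ∈ Ideal.span {(X + 1 : ℤ_[7][X]) ^ 7 ^ k - 1}) : eval₂ ι (ζ - 1) a = 0 := by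
  obtain ⟨b, rfl⟩ := Ideal.mem_span_singleton'.mp ha
  rw [eval₂_mul, eval₂_omega, hζ, sub_self, mul_zero]

/-- If `f ≡ r` and `f ≡ r′ (mod ω_k·Λ)` for polynomials `r, r′`, then `ω_k ∣ r − r′` in `ℤ₇[X]` (Weierstrass division is
unique: `ℤ₇[X]/(ω_k) ≅ Λ/(ω_k)`). [cite: Washington1997, Prop. 7.2] [cite: Lang1990, Ch. 5 §2 Thm. 2.1] -/
theorem sub_mem_span_omega_of_coe {k : ℕ} {f : PowerSeries ℤ_[7]} {r r' : ℤ_[7][X]}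
    (hr : f - (r : PowerSeries ℤ_[7]) ∈
      Ideal.span {(((X + 1 : ℤ_[7][X]) ^ 7 ^ k - 1 : ℤ_[7][X]) : PowerSeries ℤ_[7])})
    (hr' : f - (r' : PowerSeries ℤ_[7]) ∈
      Ideal.span {(((X + 1 : ℤ_[7][X]) ^ 7 ^ k - 1 : ℤ_[7][X]) : PowerSeries ℤ_[7])}) :
    r - r' ∈ Ideal.span {(X + 1 : ℤ_[7][X]) ^ 7 ^ k - 1} := by
  set e := (IwasawaH1Exists.isDistinguishedAt_omega 7 k).algEquivQuotient with he
  have hq : Ideal.Quotient.mk (Ideal.span {(((X + 1 : ℤ_[7][X]) ^ 7 ^ k - 1 : ℤ_[7][X]) : PowerSeries ℤ_[7])})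
      (r : PowerSeries ℤ_[7]) = Ideal.Quotient.mk _ (r' : PowerSeries ℤ_[7]) := by
    rw [Ideal.Quotient.mk_eq_mk_iff_sub_mem]
    have : (r : PowerSeries ℤ_[7]) - (r' : PowerSeries ℤ_[7]) =
        (f - (r' : PowerSeries ℤ_[7])) - (f - (r : PowerSeries ℤ_[7])) := by ring
    rw [this]
    exact Ideal.sub_mem _ hr' hr
  have h2 : ∀ s : ℤ_[7][X], e (Ideal.Quotient.mk _ s) = Ideal.Quotient.mk _ (s : PowerSeries ℤ_[7]) := fun s ↦ by
    simp [he, Polynomial.IsDistinguishedAt.algEquivQuotient]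
  rw [← Ideal.Quotient.mk_eq_mk_iff_sub_mem]
  apply e.injective
  rw [h2, h2, hq]

/-- **The evaluation character `ρ_{ι₇,ζ} : Λ = ℤ₇⟦X⟧ → ℂ`** at a `7`-power root of unity `ζ ∈ ℂ` (`ζ^{7ⁿ} = 1` for some `n`),
constants read through `ι₇ : ℚ₇ → ℂ`, `X ↦ ζ − 1`: the composite `Λ ↠ Λ/(ω_n) ≅ ℤ₇[X]/(ω_n) → ℂ`, `ω_n = (X+1)^{7ⁿ} − 1`
(Weierstrass division; `eval₂` at `ζ − 1` kills `ω_n`).  The level `n` is `Classical.choose hζ`; the value does not depend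
on it (`evalHom_eq_eval₂`). [cite: Lang1990, Ch. 5 §1 Thm. 1.1] [cite: Washington1997, Thm. 7.1 and Prop. 7.2] -/
def evalHom (ι₇ : ℚ_[7] →+* ℂ) (ζ : ℂ) (hζ : ∃ n : ℕ, ζ ^ 7 ^ n = 1) : IwasawaAlgebra 7 →+* ℂ :=
  ((Ideal.Quotient.lift (Ideal.span {(X + 1 : ℤ_[7][X]) ^ 7 ^ Classical.choose hζ - 1})
      (eval₂RingHom (ι₇.comp (algebraMap ℤ_[7] ℚ_[7])) (ζ - 1))
      (fun _ ha ↦ eval₂_eq_zero_of_mem_span_omega _ (Classical.choose_spec hζ) ha)).comp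
    (IwasawaH1Exists.isDistinguishedAt_omega 7 (Classical.choose hζ)).algEquivQuotient.symm.toRingEquiv.toRingHom).comp
    (Ideal.Quotient.mk _)

/-- The defining property at the defining level: `ρ(f) = r(ζ − 1)` for `r ≡ f (mod ω_{n(ζ)})`. [cite: Washington1997, Prop. 7.2] -/
theorem evalHom_eq_eval₂_choose (ι₇ : ℚ_[7] →+* ℂ) (ζ : ℂ) (hζ : ∃ n : ℕ, ζ ^ 7 ^ n = 1)
    {f : PowerSeries ℤ_[7]} {r : ℤ_[7][X]}
    (hfr : f - (r : PowerSeries ℤ_[7]) ∈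
      Ideal.span {(((X + 1 : ℤ_[7][X]) ^ 7 ^ Classical.choose hζ - 1 : ℤ_[7][X]) : PowerSeries ℤ_[7])}) :
    evalHom ι₇ ζ hζ f = eval₂ (ι₇.comp (algebraMap ℤ_[7] ℚ_[7])) (ζ - 1) r := by
  set e := (IwasawaH1Exists.isDistinguishedAt_omega 7 (Classical.choose hζ)).algEquivQuotient with he
  have h1 : Ideal.Quotient.mk (Ideal.span {(((X + 1 : ℤ_[7][X]) ^ 7 ^ Classical.choose hζ - 1 : ℤ_[7][X]) :
      PowerSeries ℤ_[7])}) f = Ideal.Quotient.mk _ (r : PowerSeries ℤ_[7]) :=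
    (Ideal.Quotient.mk_eq_mk_iff_sub_mem _ _).mpr hfr
  have h2 : e (Ideal.Quotient.mk _ r) = Ideal.Quotient.mk _ (r : PowerSeries ℤ_[7]) := by
    simp [he, Polynomial.IsDistinguishedAt.algEquivQuotient]
  rw [evalHom, RingHom.comp_apply, RingHom.comp_apply, h1, ← h2]
  change Ideal.Quotient.lift _ _ _ (e.symm (e (Ideal.Quotient.mk _ r))) = _
  rw [AlgEquiv.symm_apply_apply, Ideal.Quotient.lift_mk]
  rfl

/-- `ω_j ∣ ω_m` for `j ≤ m`. [cite: Lang1990, Ch. 5 §1 Thm. 1.1] -/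
theorem omega_dvd_omega_of_le {j m : ℕ} (hjm : j ≤ m) :
    ((X + 1 : ℤ_[7][X]) ^ 7 ^ j - 1) ∣ ((X + 1 : ℤ_[7][X]) ^ 7 ^ m - 1) := by
  obtain ⟨t, rfl⟩ := Nat.exists_eq_add_of_le hjm
  have := sub_dvd_pow_sub_pow ((X + 1 : ℤ_[7][X]) ^ 7 ^ j) 1 (7 ^ t)
  rwa [one_pow, ← pow_mul, ← pow_add] at this

/-- **Level independence**: for EVERY `k` with `ζ^{7^k} = 1` and every polynomial `r ≡ f (mod ω_k)`, `ρ(f) = r(ζ − 1)`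
(`ω_{min(k,n)}` divides `ω_k` and `ω_n`, and `ζ^{7^{min}} = 1`). [cite: Lang1990, Ch. 5 §1 Thm. 1.1] [cite: Washington1997, Prop. 7.2] -/
theorem evalHom_eq_eval₂ (ι₇ : ℚ_[7] →+* ℂ) (ζ : ℂ) (hζ : ∃ n : ℕ, ζ ^ 7 ^ n = 1) {k : ℕ} (hk : ζ ^ 7 ^ k = 1)
    {f : PowerSeries ℤ_[7]} {r : ℤ_[7][X]}
    (hfr : f - (r : PowerSeries ℤ_[7]) ∈
      Ideal.span {(((X + 1 : ℤ_[7][X]) ^ 7 ^ k - 1 : ℤ_[7][X]) : PowerSeries ℤ_[7])}) :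
    evalHom ι₇ ζ hζ f = eval₂ (ι₇.comp (algebraMap ℤ_[7] ℚ_[7])) (ζ - 1) r := by
  have hnζ : ζ ^ 7 ^ Classical.choose hζ = 1 := Classical.choose_spec hζ
  obtain ⟨rn, hrn⟩ := IwasawaH1Exists.exists_polynomial_sub_coe_mem_span 7 (Classical.choose hζ) f
  rw [evalHom_eq_eval₂_choose ι₇ ζ hζ hrn]
  -- both congruences descend to the level `j := min k n`
  have hjζ : ζ ^ 7 ^ min k (Classical.choose hζ) = 1 := by
    rcases min_choice k (Classical.choose hζ) with h | h <;> rw [h]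
    · exact hk
    · exact hnζ
  have hdesc : ∀ {m : ℕ} (_ : min k (Classical.choose hζ) ≤ m) {s : ℤ_[7][X]},
      f - (s : PowerSeries ℤ_[7]) ∈
        Ideal.span {(((X + 1 : ℤ_[7][X]) ^ 7 ^ m - 1 : ℤ_[7][X]) : PowerSeries ℤ_[7])} →
      f - (s : PowerSeries ℤ_[7]) ∈
        Ideal.span {(((X + 1 : ℤ_[7][X]) ^ 7 ^ min k (Classical.choose hζ) - 1 : ℤ_[7][X]) : PowerSeries ℤ_[7])} := by
    intro m hjm s hs
    have hdvd := omega_dvd_omega_of_le hjm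
    exact Ideal.span_singleton_le_span_singleton.mpr
      (map_dvd (Polynomial.coeToPowerSeries.ringHom (R := ℤ_[7])) hdvd) hs
  have hdiff := sub_mem_span_omega_of_coe (hdesc (min_le_right k _) hrn) (hdesc (min_le_left k _) hfr)
  rw [← sub_eq_zero, ← eval₂_sub]
  exact eval₂_eq_zero_of_mem_span_omega _ hjζ hdiff

/-- `ρ` on a polynomial: `ρ(r) = r(ζ − 1)`. [cite: Washington1997, Prop. 7.2] -/
theorem evalHom_coe (ι₇ : ℚ_[7] →+* ℂ) (ζ : ℂ) (hζ : ∃ n : ℕ, ζ ^ 7 ^ n = 1) (r : ℤ_[7][X]) :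
    evalHom ι₇ ζ hζ (r : PowerSeries ℤ_[7]) = eval₂ (ι₇.comp (algebraMap ℤ_[7] ℚ_[7])) (ζ - 1) r :=
  evalHom_eq_eval₂_choose ι₇ ζ hζ (by rw [sub_self]; exact Ideal.zero_mem _)

/-- `ρ(C c) = ι₇(c)`. [cite: Kato2004Asterisque, Thm. 12.5 (1) (p. 221)] -/
theorem evalHom_C (ι₇ : ℚ_[7] →+* ℂ) (ζ : ℂ) (hζ : ∃ n : ℕ, ζ ^ 7 ^ n = 1) (c : ℤ_[7]) :
    evalHom ι₇ ζ hζ (PowerSeries.C c) = ι₇ (c : ℚ_[7]) := by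
  rw [← Polynomial.coe_C, evalHom_coe, eval₂_C]
  rfl

/-- `ρ(X) = ζ − 1`. [cite: Kato2004Asterisque, (15.12.2) (p. 263)] -/
theorem evalHom_X (ι₇ : ℚ_[7] →+* ℂ) (ζ : ℂ) (hζ : ∃ n : ℕ, ζ ^ 7 ^ n = 1) : evalHom ι₇ ζ hζ PowerSeries.X = ζ - 1 := by
  rw [← Polynomial.coe_X, evalHom_coe, eval₂_X]

/-- `ρ(1 + X) = ζ`. [cite: Kato2004Asterisque, (15.12.2) (p. 263)] -/
theorem evalHom_one_add_X (ι₇ : ℚ_[7] →+* ℂ) (ζ : ℂ) (hζ : ∃ n : ℕ, ζ ^ 7 ^ n = 1) : evalHom ι₇ ζ hζ (1 + PowerSeries.X) = ζ := by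
  rw [map_add, map_one, evalHom_X, add_sub_cancel]

/-- `ρ((1 + X)^a) = ζ^a` for `a ∈ ℕ`. [cite: Kato2004Asterisque, (15.12.2) (p. 263)] -/
theorem evalHom_one_add_X_pow (ι₇ : ℚ_[7] →+* ℂ) (ζ : ℂ) (hζ : ∃ n : ℕ, ζ ^ 7 ^ n = 1) (a : ℕ) :
    evalHom ι₇ ζ hζ ((1 + PowerSeries.X) ^ a) = ζ ^ a := by
  rw [map_pow, evalHom_one_add_X]

/-- `ρ` sends units of `Λ` to non-zero complex numbers. [folklore] -/
theorem evalHom_units_ne_zero (ι₇ : ℚ_[7] →+* ℂ) (ζ : ℂ) (hζ : ∃ n : ℕ, ζ ^ 7 ^ n = 1) (u : (IwasawaAlgebra 7)ˣ) :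
    evalHom ι₇ ζ hζ u ≠ 0 := (u.isUnit.map (evalHom ι₇ ζ hζ)).ne_zero

/-- ★ **The tree's Amice-residue evaluation `charEval` IS `ρ`**: for `ζ^{7^N} = 1` and every `f ∈ Λ`,
`charEval 7 (ι₇ ∘ ℤ₇) ζ N f = evalHom ι₇ ζ _ f` — by the tree's `val_smul_eq_charEval_mul` applied to the `Λ`-module `ℂ`
(scalars acting through `ρ`) with the identity value map (`ρ(1+X) = ζ`, `ρ(C c) = ι₇ c`).  Hence `charEval` at level `N` is a
ring homomorphism and does not depend on `N`. [cite: Washington1997, §7.1 Thm. 7.1 and §12.2 (p. 238)] -/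
theorem charEval_eq_evalHom (ι₇ : ℚ_[7] →+* ℂ) {ζ : ℂ} {N : ℕ} (hζ : ζ ^ 7 ^ N = 1) (f : IwasawaAlgebra 7) :
    charEval 7 (ι₇.comp (algebraMap ℤ_[7] ℚ_[7])) ζ N f = evalHom ι₇ ζ ⟨N, hζ⟩ f := by
  letI : Module (IwasawaAlgebra 7) ℂ := Module.compHom ℂ (evalHom ι₇ ζ ⟨N, hζ⟩)
  have hsmul : ∀ (g : IwasawaAlgebra 7) (m : ℂ), g • m = evalHom ι₇ ζ ⟨N, hζ⟩ g * m := fun _ _ ↦ rfl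
  have hT : ∀ m : ℂ, AddMonoidHom.id ℂ ((1 + PowerSeries.X : IwasawaAlgebra 7) • m) = ζ * AddMonoidHom.id ℂ m := by
    intro m; rw [AddMonoidHom.id_apply, AddMonoidHom.id_apply, hsmul, evalHom_one_add_X]
  have hC : ∀ (c : ℤ_[7]) (m : ℂ), AddMonoidHom.id ℂ ((PowerSeries.C c : IwasawaAlgebra 7) • m) =
      (ι₇.comp (algebraMap ℤ_[7] ℚ_[7])) c * AddMonoidHom.id ℂ m := by
    intro c m; rw [AddMonoidHom.id_apply, AddMonoidHom.id_apply, hsmul, evalHom_C]; rfl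
  have h := val_smul_eq_charEval_mul (p := 7) (val := AddMonoidHom.id ℂ) hT hC hζ f 1
  rw [AddMonoidHom.id_apply, AddMonoidHom.id_apply, hsmul, mul_one, mul_one] at h
  exact h.symm

/-- `charEval` of a unit of `Λ` is non-zero (at a root of unity of level `N`). [cite: Washington1997, §7.1 Thm. 7.1] -/
theorem charEval_units_ne_zero (ι₇ : ℚ_[7] →+* ℂ) {ζ : ℂ} {N : ℕ} (hζ : ζ ^ 7 ^ N = 1) (u : (IwasawaAlgebra 7)ˣ) :
    charEval 7 (ι₇.comp (algebraMap ℤ_[7] ℚ_[7])) ζ N (u : IwasawaAlgebra 7) ≠ 0 := by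
  rw [charEval_eq_evalHom ι₇ hζ]
  exact evalHom_units_ne_zero ι₇ ζ _ u

/-- `charEval` is multiplicative (a consequence of `charEval = ρ`). [cite: Washington1997, §7.1 Thm. 7.1] -/
theorem charEval_mul (ι₇ : ℚ_[7] →+* ℂ) {ζ : ℂ} {N : ℕ} (hζ : ζ ^ 7 ^ N = 1) (f g : IwasawaAlgebra 7) :
    charEval 7 (ι₇.comp (algebraMap ℤ_[7] ℚ_[7])) ζ N (f * g) =
      charEval 7 (ι₇.comp (algebraMap ℤ_[7] ℚ_[7])) ζ N f * charEval 7 (ι₇.comp (algebraMap ℤ_[7] ℚ_[7])) ζ N g := by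
  simp only [charEval_eq_evalHom ι₇ hζ, map_mul]

end CharacterEvaluation

/-! ## §2 ★ `valOf` is `Λ`-semilinear through `ρ_{ι₇, χ(γK)⁻¹}` -/

section Frame

variable {W : WeierstrassCurve ℚ} [W.IsElliptic] [W.IsGloballyMinimal] [Fact (Nat.Prime 7)]
  [ContinuousSMul ℤ_[7] (W.tateModule 7)] {K : ZpExtension ℚ 7} {hK : K.IsCyclotomic}
  {γ : Field.absoluteGaloisGroup ℚ} {I : IwasawaH1Data W 7 K γ}
  {F : GenusFrame} {θu : ∀ n : ℕ, globalUnitsOf (F.layer n)} {d : GenusDatum F θu}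

namespace PinnedKatoGenusFrame

variable (Φ : PinnedKatoGenusFrame W K hK I d)

/-- (e1′) with the composite reading `ι₇ ∘ (ℤ₇ → ℚ₇)`: `valOf (C c • x) = (ι₇ ∘ ℤ₇)(c) · valOf x`. [cite: Kato2004Asterisque, Thm. 12.5 (1) (p. 221)] -/
theorem valOf_C_smul' (ι₇ : ℚ_[7] →+* ℂ) (χ : absoluteGaloisGroup Φ.Kcm →ₜ* ℂˣ) (c : ℤ_[7]) (x : Φ.IK.H) :
    Φ.valOf ι₇ χ ((PowerSeries.C c : IwasawaAlgebra 7) • x) = (ι₇.comp (algebraMap ℤ_[7] ℚ_[7])) c * Φ.valOf ι₇ χ x :=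
  Φ.valOf_C_smul ι₇ χ c x

/-- `valOf (f • x) = charEval(f) · valOf x` (the tree's `val_smul_eq_charEval_mul` at `val := valOf ι₇ χ`).
[cite: Kato2004Asterisque, Thm. 12.5 (1) (p. 221) and §13.9 (p. 230)] [cite: Washington1997, §7.1 Prop. 7.2] -/
theorem valOf_smul_charEval (ι₇ : ℚ_[7] →+* ℂ) (χ : absoluteGaloisGroup Φ.Kcm →ₜ* ℂˣ) {N : ℕ}
    (hχ : ∀ σ ∈ Φ.towerK.layerSubgroup N, χ σ = 1) (f : IwasawaAlgebra 7) (x : Φ.IK.H) :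
    Φ.valOf ι₇ χ (f • x) =
      charEval 7 (ι₇.comp (algebraMap ℤ_[7] ℚ_[7])) ((((χ Φ.γK)⁻¹ : ℂˣ)) : ℂ) N f * Φ.valOf ι₇ χ x :=
  val_smul_eq_charEval_mul (val := Φ.valOf ι₇ χ) (fun m ↦ Φ.valOf_T_smul ι₇ χ ⟨N, hχ⟩ m)
    (fun c m ↦ Φ.valOf_C_smul' ι₇ χ c m) (Φ.inv_chi_γK_pow_eq_one χ hχ) f x

/-- ★ **`Λ`-SEMILINEARITY OF THE `exp*`-VALUE READING**: for a character `χ` trivial on the layer `U_N` and EVERY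
`f ∈ Λ = ℤ₇⟦X⟧`, `valOf ι₇ χ (f • x) = ρ_{ι₇, χ(γK)⁻¹}(f) · valOf ι₇ χ x` with `ρ = evalHom` a RING HOMOMORPHISM.  Specialises
to the landed (e1) `valOf_T_smul` (`f = 1 + X`) and (e1′) `valOf_C_smul` (`f = C c`); Kato's «`ℓ(a·h) = a(χ)·ℓ(h)` for `a ∈ Λ`».
[cite: Kato2004Asterisque, Thm. 12.5 (1) (p. 221) and §13.9 (p. 230)] [cite: Lang1990, Ch. 5 §1 Thm. 1.1] -/
theorem valOf_smul (ι₇ : ℚ_[7] →+* ℂ) (χ : absoluteGaloisGroup Φ.Kcm →ₜ* ℂˣ) {N : ℕ}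
    (hχ : ∀ σ ∈ Φ.towerK.layerSubgroup N, χ σ = 1) (f : IwasawaAlgebra 7) (x : Φ.IK.H) :
    Φ.valOf ι₇ χ (f • x) =
      CharacterEvaluation.evalHom ι₇ ((((χ Φ.γK)⁻¹ : ℂˣ)) : ℂ) ⟨N, Φ.inv_chi_γK_pow_eq_one χ hχ⟩ f * Φ.valOf ι₇ χ x := by
  rw [Φ.valOf_smul_charEval ι₇ χ hχ, CharacterEvaluation.charEval_eq_evalHom ι₇ (Φ.inv_chi_γK_pow_eq_one χ hχ)]

/-- The unit form the (H) derivation uses: for `u ∈ Λˣ`, `valOf (u⁻¹ • x) = ρ(u)⁻¹ · valOf x` (and `ρ(u) ≠ 0`,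
`CharacterEvaluation.evalHom_units_ne_zero`). [cite: Kato2004Asterisque, §13.9 (p. 230) and Lemma 13.10 (1)] -/
theorem valOf_units_inv_smul (ι₇ : ℚ_[7] →+* ℂ) (χ : absoluteGaloisGroup Φ.Kcm →ₜ* ℂˣ) {N : ℕ}
    (hχ : ∀ σ ∈ Φ.towerK.layerSubgroup N, χ σ = 1) (u : (IwasawaAlgebra 7)ˣ) (x : Φ.IK.H) :
    Φ.valOf ι₇ χ (u⁻¹ • x) =
      (CharacterEvaluation.evalHom ι₇ ((((χ Φ.γK)⁻¹ : ℂˣ)) : ℂ) ⟨N, Φ.inv_chi_γK_pow_eq_one χ hχ⟩ u)⁻¹ *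
        Φ.valOf ι₇ χ x := by
  rw [Units.smul_def, Φ.valOf_smul ι₇ χ hχ, map_units_inv]

/-- **Kato's twist operator acts by a root of unity**: for `a ∈ ℤ₇` and any natural `m ≡ a (mod 7^N)`,
`valOf ((binomialSeries ℤ₇ a) • x) = (χ(γK)⁻¹)^m · valOf x` (`σ_𝔟 = γK^{a_𝔟} ↦ (1+X)^{a_𝔟}`; the tree's
`val_binomialSeries_smul`). [cite: Washington1997, §13.2] [cite: Kato2004Asterisque, §15.6 (p. 254)] -/
theorem valOf_binomialSeries_smul (ι₇ : ℚ_[7] →+* ℂ) (χ : absoluteGaloisGroup Φ.Kcm →ₜ* ℂˣ) {N : ℕ}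
    (hχ : ∀ σ ∈ Φ.towerK.layerSubgroup N, χ σ = 1) {a : ℤ_[7]} {m : ℕ}
    (ham : PadicInt.toZModPow N a = (m : ZMod (7 ^ N))) (x : Φ.IK.H) :
    Φ.valOf ι₇ χ (PowerSeries.binomialSeries ℤ_[7] a • x) = ((((χ Φ.γK)⁻¹ : ℂˣ)) : ℂ) ^ m * Φ.valOf ι₇ χ x :=
  val_binomialSeries_smul (val := Φ.valOf ι₇ χ) (fun y ↦ Φ.valOf_T_smul ι₇ χ ⟨N, hχ⟩ y)
    (Φ.inv_chi_γK_pow_eq_one χ hχ) ham x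

end PinnedKatoGenusFrame

end Frame

/-! ## §3 ★ (M-CANCEL): a non-zero `M ∈ Λ` is non-zero at every primitive character of large level -/

namespace CharacterEvaluation

/-- ★ **(M-CANCEL)**: for `M ≠ 0` in `Λ = ℤ₇⟦X⟧` and a reading `ι₇ : ℚ₇ →+* ℂ` there is a threshold `n₀` such that
`charEval 7 (ι₇∘ℤ₇) ζ (n+1) M ≠ 0` for EVERY `n ≥ n₀` and EVERY primitive `7^{n+1}`-th root of unity `ζ ∈ ℂ` — otherwise a
sequence of bad primitive roots (chosen where they exist, `exp(2πi/7^{n+1})` elsewhere) would make `M` vanish at primitive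
characters of infinitely many levels, forcing `M = 0` by the tree's ★★ `eq_zero_of_infinite_setOf_charEval_eq_zero`
(Weierstrass preparation: `M` has finitely many zeros in the open unit disc). [cite: Washington1997, Thm. 7.3]
[cite: Kato2004Asterisque, §13.9 (p. 230 l. 8–9)] -/
theorem exists_level_forall_charEval_ne_zero (ι₇ : ℚ_[7] →+* ℂ) {M : IwasawaAlgebra 7} (hM : M ≠ 0) :
    ∃ n₀ : ℕ, ∀ n : ℕ, n₀ ≤ n → ∀ ζ : ℂ, IsPrimitiveRoot ζ (7 ^ (n + 1)) →
      charEval 7 (ι₇.comp (algebraMap ℤ_[7] ℚ_[7])) ζ (n + 1) M ≠ 0 := by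
  haveI : Fact (Nat.Prime 7) := ⟨by norm_num⟩
  by_contra hcon
  push Not at hcon
  -- the set of bad levels is infinite
  set S : Set ℕ := {n | ∃ ζ : ℂ, IsPrimitiveRoot ζ (7 ^ (n + 1)) ∧
    charEval 7 (ι₇.comp (algebraMap ℤ_[7] ℚ_[7])) ζ (n + 1) M = 0} with hS
  have hSinf : S.Infinite := by
    refine Set.infinite_of_not_bddAbove fun ⟨b, hb⟩ ↦ ?_
    obtain ⟨n, hbn, ζ, hζ, h0⟩ := hcon (b + 1)
    have := hb (show n ∈ S from ⟨ζ, hζ, h0⟩)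
    omega
  -- a sequence of primitive roots, bad on `S`
  classical
  let ζs : ℕ → ℂ := fun n ↦ if h : n ∈ S then Classical.choose h else Complex.exp (2 * Real.pi * Complex.I / (7 ^ (n + 1) : ℕ))
  have hζs : ∀ n, IsPrimitiveRoot (ζs n) (7 ^ (n + 1)) := by
    intro n
    by_cases h : n ∈ S
    · simp only [ζs, dif_pos h]; exact (Classical.choose_spec h).1
    · simp only [ζs, dif_neg h]
      exact_mod_cast Complex.isPrimitiveRoot_exp (7 ^ (n + 1)) (pow_ne_zero _ (by norm_num))
  have hbad : S ⊆ {n : ℕ | charEval 7 (ι₇.comp (algebraMap ℤ_[7] ℚ_[7])) (ζs n) (n + 1) M = 0} := by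
    intro n hn
    simp only [Set.mem_setOf_eq, ζs, dif_pos hn]
    exact (Classical.choose_spec hn).2
  exact hM (eq_zero_of_infinite_setOf_charEval_eq_zero 7 ι₇ ζs hζs (hSinf.mono hbad))

/-- (M-CANCEL) for the ring homomorphism `ρ`: `evalHom ι₇ ζ _ M ≠ 0` for all primitive `ζ` of level `≥ n₀ + 1`.
[cite: Washington1997, Thm. 7.3] [cite: Kato2004Asterisque, §13.9 (p. 230)] -/
theorem exists_level_forall_evalHom_ne_zero (ι₇ : ℚ_[7] →+* ℂ) {M : IwasawaAlgebra 7} (hM : M ≠ 0) :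
    ∃ n₀ : ℕ, ∀ n : ℕ, n₀ ≤ n → ∀ (ζ : ℂ) (hζ : IsPrimitiveRoot ζ (7 ^ (n + 1))),
      evalHom ι₇ ζ ⟨n + 1, hζ.pow_eq_one⟩ M ≠ 0 := by
  obtain ⟨n₀, h⟩ := exists_level_forall_charEval_ne_zero ι₇ hM
  exact ⟨n₀, fun n hn ζ hζ ↦ by rw [← charEval_eq_evalHom ι₇ hζ.pow_eq_one]; exact h n hn ζ hζ⟩

end CharacterEvaluation

section FrameCancel

variable {W : WeierstrassCurve ℚ} [W.IsElliptic] [W.IsGloballyMinimal] [Fact (Nat.Prime 7)]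
  [ContinuousSMul ℤ_[7] (W.tateModule 7)] {K : ZpExtension ℚ 7} {hK : K.IsCyclotomic}
  {γ : Field.absoluteGaloisGroup ℚ} {I : IwasawaH1Data W 7 K γ}
  {F : GenusFrame} {θu : ∀ n : ℕ, globalUnitsOf (F.layer n)} {d : GenusDatum F θu}

/-- ★ (M-CANCEL) at the frame's primitive layer characters: for `M ≠ 0` there is `n₀` such that for all `n ≥ n₀` and every
character `χ` with `χ(γK)` a PRIMITIVE `7^{n+1}`-th root of unity (the stub's binder `IsPrimitiveRoot (χ γK) (7^(n+1))`),
`charEval 7 (ι₇∘ℤ₇) (χ(γK)⁻¹) (n+1) M ≠ 0`. [cite: Kato2004Asterisque, §13.9 (p. 230 l. 8–9)] [cite: Washington1997, Thm. 7.3] -/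
theorem PinnedKatoGenusFrame.exists_level_forall_charEval_ne_zero (Φ : PinnedKatoGenusFrame W K hK I d)
    (ι₇ : ℚ_[7] →+* ℂ) {M : IwasawaAlgebra 7} (hM : M ≠ 0) :
    ∃ n₀ : ℕ, ∀ n : ℕ, n₀ ≤ n → ∀ χ : absoluteGaloisGroup Φ.Kcm →ₜ* ℂˣ,
      IsPrimitiveRoot (((χ Φ.γK : ℂˣ)) : ℂ) (7 ^ (n + 1)) →
      charEval 7 (ι₇.comp (algebraMap ℤ_[7] ℚ_[7])) ((((χ Φ.γK)⁻¹ : ℂˣ)) : ℂ) (n + 1) M ≠ 0 := by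
  obtain ⟨n₀, h⟩ := CharacterEvaluation.exists_level_forall_charEval_ne_zero ι₇ hM
  refine ⟨n₀, fun n hn χ hχ ↦ h n hn _ ?_⟩
  rw [Units.val_inv_eq_inv_val]
  exact hχ.inv

end FrameCancel

/-! ## §4 `√−7 ∉ ℚ₇` and the non-vanishing of the branch constant -/

namespace CharacterEvaluation

/-- **`−7` is not a square in `ℚ₇`** (`x² = −7` would give `x⁴ = 49`, i.e. `4·v(x) = 2` for the `7`-adic valuation).
[cite: SerreLocalFields1979, II §1–§2 (discrete valuation of ℚ_p: v(xy) = v(x) + v(y))] -/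
theorem not_isSquare_neg_seven_padic : ¬ IsSquare (-7 : ℚ_[7]) := by
  haveI : Fact (Nat.Prime 7) := ⟨by norm_num⟩
  rintro ⟨x, hx⟩
  have hx0 : x ≠ 0 := by rintro rfl; norm_num at hx
  have h49 : (x * x) * (x * x) = ((7 : ℕ) : ℚ_[7]) * ((7 : ℕ) : ℚ_[7]) := by rw [← hx]; norm_num
  have hv := congrArg Padic.valuation h49
  have h7 : ((7 : ℕ) : ℚ_[7]) ≠ 0 := by exact_mod_cast (show (7 : ℕ) ≠ 0 by norm_num)
  rw [Padic.valuation_mul (mul_ne_zero hx0 hx0) (mul_ne_zero hx0 hx0), Padic.valuation_mul hx0 hx0,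
    Padic.valuation_mul h7 h7, Padic.valuation_p] at hv
  omega

/-- **The branch constant vanishes only trivially**: if `r² = −7` in `ℂ` and `ι₇ a + ι₇ b · r = 0` for `a, b ∈ ℚ₇`, then
`a = 0` and `b = 0` (else `r = −ι₇(a/b)` would give `(a/b)² = −7` in `ℚ₇`).  Used with `r = ιC(√−7)`, `(a, b) = (α₀, α₁)`:
the ★-law's constant `A = ι₇α₀ + ι₇α₁·ιC(√−7)` is non-zero whenever `(α₀, α₁) ≠ 0` (pen D1124, (S-★′)).
[cite: SerreLocalFields1979, II §1–§2 (discrete valuation of ℚ_p: v(xy) = v(x) + v(y))] [cite: Kato2004Asterisque, 15.11 (2) (pp. 261–262)] -/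
theorem eq_zero_of_add_mul_eq_zero_of_sq_eq_neg_seven (ι₇ : ℚ_[7] →+* ℂ) {r : ℂ} (hr : r ^ 2 = -7)
    {a b : ℚ_[7]} (h : ι₇ a + ι₇ b * r = 0) : a = 0 ∧ b = 0 := by
  by_cases hb : b = 0
  · subst hb; rw [map_zero, zero_mul, add_zero, map_eq_zero] at h; exact ⟨h, rfl⟩
  · exfalso
    apply not_isSquare_neg_seven_padic
    refine ⟨-(a / b), ?_⟩
    apply ι₇.injective
    have hbC : ι₇ b ≠ 0 := (map_ne_zero ι₇).mpr hb
    have hr' : r = -(ι₇ a / ι₇ b) := by field_simp; linear_combination h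
    rw [map_neg, map_ofNat, ← hr, hr', map_mul, map_neg, map_div₀]
    ring

end CharacterEvaluation

end Summit.BirchSwinnertonDyer.Rank1Residual.Additive.GenusSeven

end
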